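import Literature.Geometry.Lorentzian.BondiBartnikGap
import Literature.Geometry.Lorentzian.NearKerrCollarCore
import HarnessLib

/-!
# Vocabulary of the line `direct-method-on-the-cone` for the crux `BondiBartnikRigidity`
# (stmt-FinalStateConjecture-10807, route `BartnikGapSettling`): Kerr boxes, the faithful future
# domain of dependence, the Killing domain of a thick collar core, `ExactMinimiserKerrness`

The registered skeleton `Cruxes/BondiBartnikRigidity/Lines/direct_method_on_the_cone.lean`
(planner, 2026-08-16; line lead a2) types its five genuine stubs (K1 `stub_exactMinimiserStationary`,
K2 `stub_stationaryKerrCollarExtension`, K3 `stub_compactnessToKerrInterior`, K4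
`stub_farCompletion`, the probe sector) over six local declarations.  A stub lands under
`Theorems/` only as a `--supports` file proving the registered signature verbatim, and Theorems
files cannot import the Cruxes tree; so the six declarations are moved here VERBATIM (bodies
byte-identical to the skeleton's `section Vocabulary` and to its `def ExactMinimiserKerrness`),
with the small bookkeeping API the stubs' proofs and the composition use.  Nothing is asserted
about the notions.

* `coordBox B τ₁ τ₂ r₁ r₂` — the open coordinate box `{τ₁ < t < τ₂, r₁ < r < r₂}` of a reference
  background (`ModelBackground`, `KerrConvergence.lean`); for the boosted Kerr star background of
  a collar chart a Kerr-star slab of times `(τ₁, τ₂)` and radii `(r₁, r₂)` (Kerr-star time and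
  slabs: Dafermos–Rodnianski arXiv:0811.0354, §5.1).
* `IsNearModelBox 𝒮 B k ε τ₁ τ₂ r₁ r₂ J Ψ` — `Ψ` is smooth on the box and an open embedding of it,
  maps it into `J`, and the `Cᵏ` sup norm over the (open, four-dimensional) box of the deviation
  `Ψ^* g − g_B` is `≤ ε` (LAYER certification, as in `CauchyDevelopment.IsSoundNearKerrLeaf`;
  `ε = 0`: an exact copy of the model box).  Chart/deviation vocabulary in consequence form:
  DHRT arXiv:2104.08222, §1.
* `shellSlab B M` — the slice `{t = 0, 2M < r ≤ 3M}` of the strictly stationary shell of a collar.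
* `futureDomain 𝒮 W` — the FAITHFUL future domain of dependence `D⁺(W)`: every past-ENDLESS
  (`IsPastEndless`, `Causality.lean` §Endpoints) future-directed causal curve through `q` meets `W`
  at or before `q` (Hawking–Ellis 1973, §6.5).  The library's
  `LorentzianMetric.futureCauchyDevelopment` is the same formula over the vendored
  `IsPastInextendible`, under which every curve parametrised over `ℝ` is inextendible, so that a
  short past timelike segment from `q` reparametrised over `ℝ` disqualifies every `q ∉ W` and
  `D⁺(W)` degenerates to (roughly) `W` (docstring of §Endpoints of `Causality.lean`); the planner's
  self-refutation pass (δ) replaced it by this faithful version, kept here under the skeleton's name.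
* `killingDomain 𝒱 M p B Φ` — for ONE thick collar core `C = collarCore M p B Φ`:
  `D⁺(C ∪ N_out)`, `N_out = ∂J⁺(C) ∩ J⁺(Φ₀(shell slab))` the outer roof.
* `ExactMinimiserKerrness` — what K1 ∘ K2 deliver and K3 consumes (a closed `Prop`, route-posited
  and OPEN: an exact Bondi–Bartnik minimiser with an exact thick Kerr collar, in any maximal vacuum
  development of any smooth data, contains exact Kerr-star boxes of every radius and length inside
  `J⁺(C)`); the skeleton proves it from K1 and K2 by pure logic.

API: `mem_coordBox`, `coordBox_mono`, `IsNearModelBox.mono` / `.mono_set` and projections,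
`mem_shellSlab`, `shellSlab_subset_truncTimeSlab`, `subset_futureDomain`, `futureDomain_mono`,
`collarCore_subset_killingDomain`, `mem_killingDomain_self`.

References: Dafermos–Rodnianski arXiv:0811.0354, §5.1; Dafermos–Holzegel–Rodnianski–Taylor
arXiv:2104.08222, §1; Hawking–Ellis 1973, §6.5; Huang–Lee arXiv:2007.00593, Def. 7.8 (the
Bartnik-type minimisation the route transplants). [DafermosRodnianski2008]
[DafermosHolzegelRodnianskiTaylor2021] [HawkingEllis1973CUP] [HuangLee2020]
-/

noncomputable section

-- D-0017: single-problem summit, `Summit.<S>.<S>.…` by design (cf. lakefile `weak.linter.dupNamespace`).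
set_option linter.dupNamespace false

open Set Filter Function Topology TopologicalSpace
open Literature.Geometry.Lorentzian
open scoped Manifold ContDiff Topology ENNReal

namespace Summit.FinalStateConjecture.FinalStateConjecture.Theorems.BondiBartnikRigidity.DirectMethod

universe u

/-! ### Coordinate boxes of a reference background and `(ε, k)`-boxes of a spacetime -/

/-- The open COORDINATE BOX `{τ₁ < t < τ₂, r₁ < r < r₂}` of a reference background (for the boosted
Kerr star background of a collar: a Kerr-star slab of times `(τ₁, τ₂)` and radii `(r₁, r₂)`;
Kerr-star time `t*` and the slabs `{t* = τ}`: Dafermos–Rodnianski arXiv:0811.0354, §5.1).  Verbatim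
the skeleton's `coordBox`. [cite: DafermosRodnianski2008, §5.1] -/
def coordBox (B : ModelBackground) (τ₁ τ₂ r₁ r₂ : ℝ) : Set B.domain :=
  {x | τ₁ < B.time x.1 ∧ B.time x.1 < τ₂ ∧ r₁ < B.radius x.1 ∧ B.radius x.1 < r₂}

/-- Membership in a coordinate box. [folklore] -/
theorem mem_coordBox {B : ModelBackground} {τ₁ τ₂ r₁ r₂ : ℝ} {x : B.domain} :
    x ∈ coordBox B τ₁ τ₂ r₁ r₂ ↔
      τ₁ < B.time x.1 ∧ B.time x.1 < τ₂ ∧ r₁ < B.radius x.1 ∧ B.radius x.1 < r₂ :=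
  Iff.rfl

/-- Coordinate boxes are monotone in their bounds. [folklore] -/
theorem coordBox_mono (B : ModelBackground) {τ₁ τ₂ r₁ r₂ τ₁' τ₂' r₁' r₂' : ℝ} (h₁ : τ₁' ≤ τ₁)
    (h₂ : τ₂ ≤ τ₂') (h₃ : r₁' ≤ r₁) (h₄ : r₂ ≤ r₂') :
    coordBox B τ₁ τ₂ r₁ r₂ ⊆ coordBox B τ₁' τ₂' r₁' r₂' :=
  fun _ hx ↦ ⟨h₁.trans_lt hx.1, hx.2.1.trans_le h₂, h₃.trans_lt hx.2.2.1, hx.2.2.2.trans_le h₄⟩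

/-- **`(ε, k)`-box of the background `B` inside `J`**: the chart `Ψ` is smooth on the coordinate box
and an open embedding of it, maps it into `J`, and the `Cᵏ` sup norm over the (open,
`4`-dimensional) box of the deviation `Ψ^* g − g_B` (`Spacetime.deviationExtend`) is `≤ ε` — LAYER
certification in the sense of `CauchyDevelopment.IsSoundNearKerrLeaf`, not slab certification;
`ε = 0`: an exact copy of the model box.  Verbatim the skeleton's `IsNearModelBox`.  Chart /
deviation vocabulary in consequence form: DHRT arXiv:2104.08222, §1.
[cite: DafermosHolzegelRodnianskiTaylor2021, §1] -/
def IsNearModelBox (𝒮 : Spacetime.{u} 4) (B : ModelBackground) (k : ℕ) (ε : ℝ≥0∞)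
    (τ₁ τ₂ r₁ r₂ : ℝ) (J : Set 𝒮.carrier) (Ψ : B.domain → 𝒮.carrier) : Prop :=
  ContMDiffOn 𝓘(ℝ, E4) (𝓡 4) ∞ Ψ (coordBox B τ₁ τ₂ r₁ r₂) ∧
    IsOpenEmbedding ((coordBox B τ₁ τ₂ r₁ r₂).restrict Ψ) ∧
    Ψ '' coordBox B τ₁ τ₂ r₁ r₂ ⊆ J ∧
    supCkENorm (Subtype.val '' coordBox B τ₁ τ₂ r₁ r₂) k (𝒮.deviationExtend B Ψ) ≤ ε

namespace IsNearModelBox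

variable {𝒮 : Spacetime.{u} 4} {B : ModelBackground} {k k' : ℕ} {ε ε' : ℝ≥0∞}
  {τ₁ τ₂ r₁ r₂ : ℝ} {J J' : Set 𝒮.carrier} {Ψ : B.domain → 𝒮.carrier}

/-- **Monotonicity in `(k, ε)`**: an `(ε, k')`-box is an `(ε', k)`-box for `k ≤ k'`, `ε ≤ ε'`
(`supCkENorm_mono_right`; closeness with loss of derivatives, DHRT arXiv:2104.08222, §1).
[cite: DafermosHolzegelRodnianskiTaylor2021, §1] -/
theorem mono (h : IsNearModelBox 𝒮 B k' ε τ₁ τ₂ r₁ r₂ J Ψ) (hk : k ≤ k') (hε : ε ≤ ε') :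
    IsNearModelBox 𝒮 B k ε' τ₁ τ₂ r₁ r₂ J Ψ :=
  ⟨h.1, h.2.1, h.2.2.1, ((supCkENorm_mono_right _ hk _).trans h.2.2.2).trans hε⟩

/-- A box inside `J` is a box inside any `J' ⊇ J`. [folklore] -/
theorem mono_set (h : IsNearModelBox 𝒮 B k ε τ₁ τ₂ r₁ r₂ J Ψ) (hJ : J ⊆ J') :
    IsNearModelBox 𝒮 B k ε τ₁ τ₂ r₁ r₂ J' Ψ :=
  ⟨h.1, h.2.1, h.2.2.1.trans hJ, h.2.2.2⟩

/-- The chart of an `(ε, k)`-box is smooth on the box. [folklore] -/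
theorem contMDiffOn (h : IsNearModelBox 𝒮 B k ε τ₁ τ₂ r₁ r₂ J Ψ) :
    ContMDiffOn 𝓘(ℝ, E4) (𝓡 4) ∞ Ψ (coordBox B τ₁ τ₂ r₁ r₂) :=
  h.1

/-- The chart of an `(ε, k)`-box is an open embedding of the box. [folklore] -/
theorem isOpenEmbedding (h : IsNearModelBox 𝒮 B k ε τ₁ τ₂ r₁ r₂ J Ψ) :
    IsOpenEmbedding ((coordBox B τ₁ τ₂ r₁ r₂).restrict Ψ) :=
  h.2.1

/-- The image of an `(ε, k)`-box inside `J` lies in `J`. [folklore] -/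
theorem image_subset (h : IsNearModelBox 𝒮 B k ε τ₁ τ₂ r₁ r₂ J Ψ) :
    Ψ '' coordBox B τ₁ τ₂ r₁ r₂ ⊆ J :=
  h.2.2.1

/-- The `Cᵏ` deviation over an `(ε, k)`-box is at most `ε`. [folklore] -/
theorem supCkENorm_le (h : IsNearModelBox 𝒮 B k ε τ₁ τ₂ r₁ r₂ J Ψ) :
    supCkENorm (Subtype.val '' coordBox B τ₁ τ₂ r₁ r₂) k (𝒮.deviationExtend B Ψ) ≤ ε :=
  h.2.2.2

end IsNearModelBox

/-! ### The shell slab, the faithful future domain of dependence, the Killing domain -/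

/-- The slice of the STRICTLY STATIONARY SHELL `{t* = 0, 2M < r ≤ 3M}` of a collar chart's
background (outside the ergoregion `r ≤ r_E(θ) ≤ 2M`; its outer edge is the sphere `S₃ = {r = 3M}`
from which the outer roof `N_out` of the collar is ruled).  Verbatim the skeleton's `shellSlab`
(Kerr-star slabs and the ergoregion: Dafermos–Rodnianski arXiv:0811.0354, §5.1).
[cite: DafermosRodnianski2008, §5.1] -/
def shellSlab (B : ModelBackground) (M : ℝ) : Set B.domain :=
  {x | B.time x.1 = 0 ∧ 2 * M < B.radius x.1 ∧ B.radius x.1 ≤ 3 * M}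

/-- Membership in the shell slab. [folklore] -/
theorem mem_shellSlab {B : ModelBackground} {M : ℝ} {x : B.domain} :
    x ∈ shellSlab B M ↔ B.time x.1 = 0 ∧ 2 * M < B.radius x.1 ∧ B.radius x.1 ≤ 3 * M :=
  Iff.rfl

/-- For `0 ≤ M` the shell slab lies in the thick collar slab `{t = 0, r ≤ 3M}`
(`ModelBackground.truncTimeSlab (3 * M) 0`). [folklore] -/
theorem shellSlab_subset_truncTimeSlab (B : ModelBackground) (M : ℝ) :
    shellSlab B M ⊆ B.truncTimeSlab (3 * M) 0 :=
  fun _ hx ↦ ⟨hx.1, hx.2.2⟩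

/-- **Future domain of dependence `D⁺(W)`, faithful form**: the points `q` such that every
past-ENDLESS future-directed causal curve through `q` meets `W` at or before `q` (Hawking–Ellis
1973, §6.5).  The library's `LorentzianMetric.futureCauchyDevelopment` is the same formula over the
vendored `IsPastInextendible`, under which every curve parametrised over `ℝ` counts as inextendible
(docstring of the section `Endpoints` of `Causality.lean`), so that a short past timelike segment
from `q` reparametrised over `ℝ` disqualifies every `q ∉ W` and that set degenerates to (roughly)
`W`; here the faithful `IsPastEndless` (no past endpoint) is used instead.  Verbatim the skeleton's
`futureDomain`. [cite: HawkingEllis1973CUP, §6.5] -/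
def futureDomain (𝒮 : Spacetime.{u} 4) (W : Set 𝒮.carrier) : Set 𝒮.carrier :=
  {q | ∀ (γ : ℝ → 𝒮.carrier) (s : Set ℝ), s.OrdConnected →
    𝒮.metric.IsFutureCausalCurveOn 𝒮.timeOrientation γ s → IsPastEndless γ s →
    ∀ t₀ ∈ s, γ t₀ = q → ∃ t ∈ s, t ≤ t₀ ∧ γ t ∈ W}

/-- `W ⊆ D⁺(W)`: a curve through `q ∈ W` meets `W` at `q` itself (Hawking–Ellis 1973, §6.5).
[cite: HawkingEllis1973CUP, §6.5] -/
theorem subset_futureDomain (𝒮 : Spacetime.{u} 4) (W : Set 𝒮.carrier) : W ⊆ futureDomain 𝒮 W :=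
  fun _ hq _ _ _ _ _ t₀ ht₀ hγ ↦ ⟨t₀, ht₀, le_rfl, hγ ▸ hq⟩

/-- `D⁺` is monotone: `W ⊆ W' → D⁺(W) ⊆ D⁺(W')` (Hawking–Ellis 1973, §6.5).
[cite: HawkingEllis1973CUP, §6.5] -/
theorem futureDomain_mono (𝒮 : Spacetime.{u} 4) {W W' : Set 𝒮.carrier} (h : W ⊆ W') :
    futureDomain 𝒮 W ⊆ futureDomain 𝒮 W' := by
  intro q hq γ s hs hγ he t₀ ht₀ hqt
  obtain ⟨t, ht, htt₀, hW⟩ := hq γ s hs hγ he t₀ ht₀ hqt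
  exact ⟨t, ht, htt₀, h hW⟩

variable {X : Type u} [TopologicalSpace X] [ChartedSpace E3 X] [IsManifold (𝓡 3) ∞ X]
  [ConnectedSpace X] {D : InitialDataSet (𝓡 3) X}

/-- **Killing domain of a single thick collar core** `C = collarCore M p B Φ` (one hole, `p ∈ C`):
`D⁺(C ∪ N_out)` (faithful `futureDomain`), where the OUTER ROOF `N_out = ∂J⁺(C) ∩ J⁺(shell slab)`
is the part of the achronal boundary of `J⁺(C)` ruled by the null generators leaving the outer edge
sphere `S₃`.  This is the region on which the direct method produces a Killing field: it contains
the exact Kerr diamond `D(C)`, the exterior `J⁺(C) ∩ {r ≥ r₊}` and the near-horizon interior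
`{M < r < r₊}` at all later Kerr-star times.  Verbatim the skeleton's `killingDomain`
(domain of dependence: Hawking–Ellis 1973, §6.5). [cite: HawkingEllis1973CUP, §6.5] -/
def killingDomain (𝒱 : VacuumCauchyDevelopment D) (M : Fin 1 → ℝ) (p : 𝒱.carrier)
    (B : Fin 1 → ModelBackground) (Φ : ∀ i, (B i).domain → 𝒱.carrier) : Set 𝒱.carrier :=
  futureDomain 𝒱.toSpacetime
    (collarCore M p B Φ ∪
      (frontier (𝒱.metric.causalFuture 𝒱.timeOrientation (collarCore M p B Φ)) ∩
        𝒱.metric.causalFuture 𝒱.timeOrientation (Φ 0 '' shellSlab (B 0) (M 0))))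

/-- The core lies in its Killing domain: `C ⊆ C ∪ N_out ⊆ D⁺(C ∪ N_out)`. [folklore] -/
theorem collarCore_subset_killingDomain (𝒱 : VacuumCauchyDevelopment D) (M : Fin 1 → ℝ)
    (p : 𝒱.carrier) (B : Fin 1 → ModelBackground) (Φ : ∀ i, (B i).domain → 𝒱.carrier) :
    collarCore M p B Φ ⊆ killingDomain 𝒱 M p B Φ :=
  subset_union_left.trans (subset_futureDomain _ _)

/-- The probe point lies in the Killing domain of its core. [folklore] -/
theorem mem_killingDomain_self (𝒱 : VacuumCauchyDevelopment D) (M : Fin 1 → ℝ) (p : 𝒱.carrier)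
    (B : Fin 1 → ModelBackground) (Φ : ∀ i, (B i).domain → 𝒱.carrier) :
    p ∈ killingDomain 𝒱 M p B Φ :=
  collarCore_subset_killingDomain 𝒱 M p B Φ (mem_collarCore_self M p B Φ)

/-- **Registered bookkeeping sub-goal of the line** (`stub_killingDomainContainsCore`, the anchor
under which this vocabulary file serves the crux item): in the summit's universe-`0` setting, the
thick collar core lies in its Killing domain, `C ⊆ D⁺(C ∪ N_out)` — the first of the inclusions
`C ⊆ killingDomain ⊆ J⁺(C)` through which K1/K2 place their boxes (Hawking–Ellis 1973, §6.5:
`S ⊆ D⁺(S)`). [cite: HawkingEllis1973CUP, §6.5] -/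
theorem stub_killingDomainContainsCore : ∀ (X : Type) [TopologicalSpace X] [ChartedSpace E3 X] [IsManifold (𝓡 3) ∞ X] [T2Space X] [SecondCountableTopology X] [ConnectedSpace X] (D : InitialDataSet (𝓡 3) X) (𝒱 : VacuumCauchyDevelopment D) (M : Fin 1 → ℝ) (p : 𝒱.carrier) (B : Fin 1 → ModelBackground) (Φ : ∀ i, (B i).domain → 𝒱.carrier), collarCore M p B Φ ⊆ killingDomain 𝒱 M p B Φ :=
  fun _ _ _ _ _ _ _ _ 𝒱 M p B Φ ↦ collarCore_subset_killingDomain 𝒱 M p B Φ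

/-! ### Exact minimiser Kerrness (the statement K1 ∘ K2 deliver and K3 consumes) -/

/-- **EXACT MINIMISER KERRNESS** — what the stubs K1 (`stub_exactMinimiserStationary`) and K2
(`stub_stationaryKerrCollarExtension`) of the line compose to and K3
(`stub_compactnessToKerrInterior`) consumes; the `N = 1` analogue, in the LIMIT CATEGORY
(`VacuumCauchyDevelopment D` over ARBITRARY smooth data, maximal for its own data, core ON its
Cauchy slice) and in chart form, of an exact-minimiser rigidity statement: an exact Bondi–Bartnik
minimiser (`NearKerrCollarCore k' 0 0`: exact `k'`-jet of boosted Kerr on the thick slab, a cut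
energy, gap `≤ 0` against admissible competitors; at least one competitor mass) with an exact thick
Kerr collar contains exact Kerr-star boxes `{τ < t* < τ + T, M < r < R + 1}` of every radius and
length inside `J⁺(C)`.  Verbatim the skeleton's `ExactMinimiserKerrness`.  A route-posited OPEN
statement (the slice analogue is the "Bartnik minimisers are stationary / static" family, Huang–Lee
arXiv:2007.00593, Thm. 10), recorded as the line's intermediate target, not as a fact.
[conjecture] [folklore] -/
def ExactMinimiserKerrness : Prop :=
  ∀ (k' : ℕ), 2 ≤ k' →
    ∀ (X : Type) [TopologicalSpace X] [ChartedSpace E3 X] [IsManifold (𝓡 3) ∞ X]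
      [T2Space X] [SecondCountableTopology X] [ConnectedSpace X]
      (D : InitialDataSet (𝓡 3) X) (𝒱 : VacuumCauchyDevelopment D)
      (M a : Fin 1 → ℝ) (p : 𝒱.carrier) (mo : Fin 1 → lorentzGroup × E4)
      (B : Fin 1 → ModelBackground) (Φ : ∀ i, (B i).domain → 𝒱.carrier),
    𝒱.IsMaximal → (∀ i, 0 < M i ∧ |a i| < M i) →
    (∃ i, p ∈ Φ i '' (B i).truncTimeSlab (3 * M i) 0) →
    collarCore M p B Φ ⊆ range 𝒱.embed →
    𝒱.NearKerrCollarCore k' 0 0 1 M a univ p mo B Φ →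
    (∃ m' : ℝ, 𝒱.IsCompetitorMass (collarCore M p B Φ) m') →
    ∀ (k : ℕ) (R T : ℝ), ∃ (τ : ℝ) (Ψ : (B 0).domain → 𝒱.carrier),
      IsNearModelBox 𝒱.toSpacetime (B 0) k 0 τ (τ + T) (M 0) (R + 1)
        (𝒱.metric.causalFuture 𝒱.timeOrientation (collarCore M p B Φ)) Ψ

end Summit.FinalStateConjecture.FinalStateConjecture.Theorems.BondiBartnikRigidity.DirectMethod

end
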